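import Summits.AtomisticToContinuum.FouriersLaw.Theses.CageBudgetFekete
import Literature.MathematicalPhysics.KineticTheory.InfiniteChainShiftInvariantUniqueness
import Literature.MathematicalPhysics.KineticTheory.InfiniteChainCorrelationContinuity
import Literature.MathematicalPhysics.KineticTheory.InfiniteChainCurrentMoments
import Literature.MathematicalPhysics.KineticTheory.InfiniteChainCurrentPositiveType
import Literature.MathematicalPhysics.KineticTheory.InfiniteChainGibbsInvariance
import Literature.MathematicalPhysics.KineticTheory.InfiniteChainSuperstableOrbits

/-!
# Line `canonical-rigidity` for crux `HeatVarianceCalculus` — route CageBudgetFekete, item stmt-AtomisticToContinuum-15772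

Strategist's ALTERNATIVE to the birth line (`Lines/birth.lean`). The crux (route decl
`Summit.AtomisticToContinuum.FouriersLaw.Theses.CageBudgetFekete.HeatVarianceCalculus`, FIXED) quantifies
over EVERY guarded pair `(μ_T, D)` — `μ_T` a shift- and momentum-reversal-invariant DLR state of the
pinned chain, `D` ANY `InfiniteChainDynamics` (arbitrary carrier, arbitrary flow off it) preserving `μ_T`
whose flow commutes with the one-step shift a.e. The birth line asks its load-bearing stub
(`stub_locallyUniformClustering`) for such an arbitrary `D`, where the tree's propagation estimate
(`InfiniteChainDynamics.exists_summable_l2_locality`, Buttà–Marchioro light cone) needs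
`D.carrier = bmGood`; its card defers the identification of `D` with the Buttà–Marchioro flow to an
unnamed "first sub-step" and points at `flow_comp_chainShift_ae_of_carrier_subset_bmGood`, whose
hypothesis `D.carrier ⊆ bmGood` an abstract guarded `D` does not satisfy.

## The move (lens: transfer to the canonical pair — DYNAMICS RIGIDITY, proved here, not stubbed)

Every guarded `D` IS the canonical Buttà–Marchioro dynamics `μ_T`-a.e., at every time:
`∀ᵐ σ ∂μ_T, ∀ t, D.flow t σ = D♭.flow t σ` for the dynamics `D♭` of
`OscillatorChain.exists_bmDynamics` (carrier `bmGood`, measurable flow maps, identity off `bmGood`).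
Proof (theorem `flow_ae_eq_canonical` below, kernel-checked): the shift-invariant DLR state is the
transfer-operator state, hence superstable (`hasSuperstabilityEstimate_of_isShiftInvariant_pinnedChain`);
by the SUP-IN-TIME form of BM (2.6) (`OscillatorChain.ae_forall_flow_mem_bmGood_pinnedChain`: for ANY
dynamics preserving a superstable state, a.e. orbit stays in `bmGood` AT ALL TIMES) a.e. `D`-orbit is a
solution of the equations of motion living in `bmGood = D♭.carrier`, so the uniqueness field of `D♭`
(BM 2016 Thm 2.1) identifies it with the `D♭`-orbit. Consequently every clause of the crux is a
statement about the ONE canonical pair `(μ_T, D♭)`, for which the tree holds: exponential ρ-mixing of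
`μ_T` (Jentzsch gap of the transfer operator, `…MourreDissolution.exists_gibbsState_mixing_pinnedChain`
/ `…GreenKuboContinuation…exists_regular_state_mixing_pinnedChain`), fixed-time `L²`-locality of
`j₀ ∘ φ_t` UNIFORMLY on `|t| ≤ τ` with a summable rate (`exists_summable_l2_locality`), the clustering
transfer with a summable majorant depending on the evolved observable only through its `L²` norm and
its locality rate (`exists_summable_majorant_covariance_comp_chainShift`), positive type of the
autocorrelation for carriers inside `bmGood` (`currentCorrelation_positiveType_of_carrier_subset_bmGood`),
and termwise continuity (`continuous_integral_bondCurrentZ_mul_flow_pinnedChain`).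

## Stubs (2, both M-sized and provable from named tree theorems) + kernel-checked composition

* `stub_canonicalClusteringMajorant` (HARDEST of the line, size M): for the CANONICAL dynamics only
  (carrier `= bmGood`, measurable flow maps, identity off `bmGood`) and a shift- and
  momentum-reversal-invariant DLR state `μ_T`: for every window `τ` a summable `m : ℤ → ℝ` with
  `|∫ j_0 (j_x ∘ φ_t) dμ_T| ≤ m x` for all `|t| ≤ τ`, `x ∈ ℤ`. Route to proof = the assembly
  `Theorems.DrudeDissolution.gibbsClustering_at_of_mixing_of_locality` re-run with the UNIFORM majorant
  theorem instead of the fixed-time summability one (G = ‖j₀‖₂ by invariance, ε from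
  `exists_summable_l2_locality` at horizon τ, K = R = 1, `∫ j₀ dμ_T = 0` by momentum reversal,
  `j₀ ∘ τ_x = j_x`, `φ_t ∘ τ_x = τ_x ∘ φ_t` by `flow_chainShift_of_eq_id`).
* `stub_laplaceHeatVariance` (size M, pure real analysis; VERBATIM the birth line's stub 3 — one proof
  closes both lines): Laplace integrability of `e^{-νt}C`, `e^{-νt}V` and
  `∫₀^∞ e^{-νt}C = (ν²/2)∫₀^∞ e^{-νt}V` for continuous bounded `C`, `V(τ) = 2∫_{(0,τ]}(τ-s)C(s)ds`.
* `HeatVarianceCalculus_of_stubs : CanonicalRigidityLine` (PROVED, no sorry): rigidity ⇒ every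
  correlation term of `D` equals that of `D♭`; (a) absolute convergence from the majorant at `τ = |t|`;
  (b) continuity by the Weierstrass M-test on open windows; (c) `V ≥ 0` and `|C| ≤ C(0)` from the
  in-tree positive type of `D♭` (carrier `⊆ bmGood`); (d) from the Laplace stub with `M = C(0)`.
  `HeatVarianceCalculus_of : HeatVarianceCalculus` concludes the crux BY NAME from the two stubs by name.

Disproof used: none exists for this crux (no `Disproof.lean`, `ledger negatives` has no entry on the
regularity of `C_T`). Costume check: no stub mentions the crux, `FouriersLaw`, an arbitrary guarded `D`,
continuity of `C_T` or `V_T ≥ 0`; the first stub is strictly about the canonical dynamics.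
-/

namespace Summit.AtomisticToContinuum.FouriersLaw.Cruxes.HeatVarianceCalculus.CanonicalRigidity

open MeasureTheory Filter Set
open scoped Topology BigOperators
open Literature.MathematicalPhysics.KineticTheory.HeatConduction

/-- **Stub 1 (hardest of the line, M): locally-uniform-in-time summable clustering of the current pair
correlations FOR THE CANONICAL BUTTÀ–MARCHIORO DYNAMICS.** For `pinnedChain ω₂ lam β γ`
(`ω₂, lam, β > 0`), `T > 0`, a shift- and momentum-reversal-invariant DLR state `μ` at `T`, and a
dynamics `D` with `D.carrier = bmGood`, measurable flow maps and `D.flow t = id` off `bmGood` (the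
triple delivered by `OscillatorChain.exists_bmDynamics`): for every `τ` there is a summable
`m : ℤ → ℝ` with `|∫ j_0 · (j_x ∘ φ_t) dμ| ≤ m x` for all `|t| ≤ τ`, `x ∈ ℤ`.
Why true / route: `μ` is the transfer-operator state (uniqueness of the shift-invariant DLR state,
`eq_of_isChainGibbsMeasure_of_isShiftInvariant_pinnedChain`), exponentially ρ-mixing between half-lines
(`Theorems.MourreDissolution.exists_gibbsState_mixing_pinnedChain`); `j₀ ∘ φ_t` is `L²(μ)`-local with a
summable rate UNIFORM on `|t| ≤ τ` (`InfiniteChainDynamics.exists_summable_l2_locality`, inputs as in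
`Theorems.MourreDissolution.stub_gibbsClustering`); the clustering transfer
`exists_summable_majorant_covariance_comp_chainShift` (level `G = ‖j₀‖₂`, margin `K = 1`, `R = 1`) gives
ONE summable majorant for all these `t`; `Cov = ∫ j₀ (j_x ∘ φ_t)` since `∫ j₀ dμ = 0` (momentum
reversal) and `(j₀ ∘ τ_x) ∘ φ_t = j_x ∘ φ_t` (`bondCurrentZ_zero_chainShift`, `flow_chainShift_of_eq_id`).
[sources: ButtaMarchioro2016 §3, Georgii2011 Thm 10.25, BonettoLebowitzReyBellet2000 §7] -/
theorem stub_canonicalClusteringMajorant :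
    ∀ ω₂ lam β γ : ℝ, 0 < ω₂ → 0 < lam → 0 < β → ∀ T : ℝ, 0 < T →
    ∀ μ : MeasureTheory.Measure Literature.MathematicalPhysics.KineticTheory.HeatConduction.ChainConfig,
    (Literature.MathematicalPhysics.KineticTheory.HeatConduction.pinnedChain ω₂ lam β γ).IsChainGibbsMeasure T μ →
    Literature.MathematicalPhysics.KineticTheory.HeatConduction.IsShiftInvariant μ →
    μ.map (fun σ : Literature.MathematicalPhysics.KineticTheory.HeatConduction.ChainConfig => fun x : ℤ => ((σ x).1, -(σ x).2)) = μ →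
    ∀ D : Literature.MathematicalPhysics.KineticTheory.HeatConduction.InfiniteChainDynamics (Literature.MathematicalPhysics.KineticTheory.HeatConduction.pinnedChain ω₂ lam β γ),
    D.carrier = (Literature.MathematicalPhysics.KineticTheory.HeatConduction.pinnedChain ω₂ lam β γ).bmGood →
    (∀ t : ℝ, Measurable (D.flow t)) →
    (∀ t : ℝ, ∀ σ ∉ (Literature.MathematicalPhysics.KineticTheory.HeatConduction.pinnedChain ω₂ lam β γ).bmGood, D.flow t σ = σ) →
    ∀ τ : ℝ, ∃ m : ℤ → ℝ, Summable m ∧ ∀ t : ℝ, |t| ≤ τ → ∀ x : ℤ,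
      |∫ σ, (Literature.MathematicalPhysics.KineticTheory.HeatConduction.pinnedChain ω₂ lam β γ).bondCurrentZ σ 0 *
          (Literature.MathematicalPhysics.KineticTheory.HeatConduction.pinnedChain ω₂ lam β γ).bondCurrentZ (D.flow t σ) x ∂μ| ≤ m x := by
  sorry

/-- **Stub 2 (M): Laplace calculus of the doubly integrated correlation (pure real analysis; verbatim
the birth line's `stub_laplaceHeatVariance`, so that ONE proof closes both lines).** For a continuous
bounded `C` and `V(τ) = 2∫_{(0,τ]} (τ - s) C(s) ds`, for every `ν > 0`: `e^{-νt} C` and `e^{-νt} V` are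
integrable on `(0, ∞)` and `∫₀^∞ e^{-νt} C(t) dt = (ν²/2) ∫₀^∞ e^{-νt} V(t) dt` (`|V(τ)| ≤ Mτ²`;
Fubini with `∫_s^∞ (t - s) e^{-νt} dt = e^{-νs}/ν²`, i.e. `V'' = 2C`, `V(0) = V'(0) = 0`).
[sources: Helfand1960; Mathlib `integral_exp_mul_Ioi`, `Real.integral_rpow_mul_exp_neg_mul_Ioi`,
`MeasureTheory.integral_integral_swap`] -/
theorem stub_laplaceHeatVariance :
    ∀ C : ℝ → ℝ, Continuous C → (∃ M : ℝ, ∀ t : ℝ, |C t| ≤ M) → ∀ V : ℝ → ℝ,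
    V = (fun τ : ℝ => 2 * ∫ s in Set.Ioc (0:ℝ) τ, (τ - s) * C s) → ∀ ν : ℝ, 0 < ν →
    MeasureTheory.IntegrableOn (fun t : ℝ => Real.exp (-(ν * t)) * C t) (Set.Ioi 0) ∧
    MeasureTheory.IntegrableOn (fun t : ℝ => Real.exp (-(ν * t)) * V t) (Set.Ioi 0) ∧
    ∫ t in Set.Ioi (0:ℝ), Real.exp (-(ν * t)) * C t =
      ν ^ 2 / 2 * ∫ t in Set.Ioi (0:ℝ), Real.exp (-(ν * t)) * V t := by
  sorry

/-! ## Dynamics rigidity (PROVED): every guarded dynamics is the canonical one, a.e., at all times -/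

/-- **Dynamics rigidity.** For the pinned chain (`ω₂, lam, β > 0`), a shift-invariant DLR state `μ`
at `T > 0`, ANY dynamics `D` preserving `μ` and ANY dynamics `D'` whose carrier is BM's good set:
`μ`-a.e. orbit of `D` is the orbit of `D'`, simultaneously for all times. (Superstability of the
shift-invariant state; sup-in-time BM (2.6) `ae_forall_flow_mem_bmGood_pinnedChain`; the uniqueness
field of `D'`.) No shift covariance and no momentum-reversal invariance is used. [folklore] -/
theorem flow_ae_eq_canonical {ω₂ lam β : ℝ} (γ : ℝ) (hω : 0 < ω₂) (hl : 0 < lam) (hβ : 0 < β)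
    {T : ℝ} (hT : 0 < T) {μ : Measure ChainConfig}
    (hG : (pinnedChain ω₂ lam β γ).IsChainGibbsMeasure T μ) (hSI : IsShiftInvariant μ)
    (D D' : InfiniteChainDynamics (pinnedChain ω₂ lam β γ)) (hP : D.PreservesMeasure μ)
    (hcar : D'.carrier = (pinnedChain ω₂ lam β γ).bmGood) :
    ∀ᵐ σ ∂μ, ∀ t : ℝ, D.flow t σ = D'.flow t σ := by
  have hss : (pinnedChain ω₂ lam β γ).HasSuperstabilityEstimate μ :=
    OscillatorChain.hasSuperstabilityEstimate_of_isShiftInvariant_pinnedChain γ hω hl.le hβ.le hT hG hSI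
  have hgood := OscillatorChain.ae_forall_flow_mem_bmGood_pinnedChain γ hω.le hl hβ hss D hP
  filter_upwards [hP.1, hgood] with σ hσ hσgood t
  have h := D'.unique (fun u => D.flow u σ) (fun u => by rw [hcar]; exact hσgood u)
    (D.isSolution σ hσ) t
  simpa only [D.flow_zero σ hσ] using h

/-! ## The line as one proposition and the kernel-checked composition -/

/-- **The line as one proposition**: `stub₁-sig → stub₂-sig → HeatVarianceCalculus` (wrapped in a
`def` so that the skeleton audit sees exactly ONE theorem concluding the crux by name). [folklore] -/
def CanonicalRigidityLine : Prop :=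
    (∀ ω₂ lam β γ : ℝ, 0 < ω₂ → 0 < lam → 0 < β → ∀ T : ℝ, 0 < T →
    ∀ μ : MeasureTheory.Measure Literature.MathematicalPhysics.KineticTheory.HeatConduction.ChainConfig,
    (Literature.MathematicalPhysics.KineticTheory.HeatConduction.pinnedChain ω₂ lam β γ).IsChainGibbsMeasure T μ →
    Literature.MathematicalPhysics.KineticTheory.HeatConduction.IsShiftInvariant μ →
    μ.map (fun σ : Literature.MathematicalPhysics.KineticTheory.HeatConduction.ChainConfig => fun x : ℤ => ((σ x).1, -(σ x).2)) = μ →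
    ∀ D : Literature.MathematicalPhysics.KineticTheory.HeatConduction.InfiniteChainDynamics (Literature.MathematicalPhysics.KineticTheory.HeatConduction.pinnedChain ω₂ lam β γ),
    D.carrier = (Literature.MathematicalPhysics.KineticTheory.HeatConduction.pinnedChain ω₂ lam β γ).bmGood →
    (∀ t : ℝ, Measurable (D.flow t)) →
    (∀ t : ℝ, ∀ σ ∉ (Literature.MathematicalPhysics.KineticTheory.HeatConduction.pinnedChain ω₂ lam β γ).bmGood, D.flow t σ = σ) →
    ∀ τ : ℝ, ∃ m : ℤ → ℝ, Summable m ∧ ∀ t : ℝ, |t| ≤ τ → ∀ x : ℤ,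
      |∫ σ, (Literature.MathematicalPhysics.KineticTheory.HeatConduction.pinnedChain ω₂ lam β γ).bondCurrentZ σ 0 *
          (Literature.MathematicalPhysics.KineticTheory.HeatConduction.pinnedChain ω₂ lam β γ).bondCurrentZ (D.flow t σ) x ∂μ| ≤ m x) →
    (∀ C : ℝ → ℝ, Continuous C → (∃ M : ℝ, ∀ t : ℝ, |C t| ≤ M) → ∀ V : ℝ → ℝ,
    V = (fun τ : ℝ => 2 * ∫ s in Set.Ioc (0:ℝ) τ, (τ - s) * C s) → ∀ ν : ℝ, 0 < ν →
    MeasureTheory.IntegrableOn (fun t : ℝ => Real.exp (-(ν * t)) * C t) (Set.Ioi 0) ∧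
    MeasureTheory.IntegrableOn (fun t : ℝ => Real.exp (-(ν * t)) * V t) (Set.Ioi 0) ∧
    ∫ t in Set.Ioi (0:ℝ), Real.exp (-(ν * t)) * C t =
      ν ^ 2 / 2 * ∫ t in Set.Ioi (0:ℝ), Real.exp (-(ν * t)) * V t) →
    Summit.AtomisticToContinuum.FouriersLaw.Theses.CageBudgetFekete.HeatVarianceCalculus

/-- **Composition, hypothesis form (kernel-checked): the two stub STATEMENTS give the crux
`HeatVarianceCalculus` for EVERY guarded pair.** Rigidity (`flow_ae_eq_canonical`) makes every
correlation term of the guarded `D` equal to the corresponding term of the canonical `D♭` of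
`exists_bmDynamics`; (a) absolute convergence from the majorant of Stub 1 at the window `τ = |t|` and
the in-tree integrability of the terms; (b) continuity of `C_T = Σ_x c_x` by the Weierstrass M-test on
open windows, each `c_x` continuous in tree; (c) `V_T ≥ 0` and `|C_T| ≤ C_T(0)` from the in-tree positive
type of `D♭` (carrier `⊆ bmGood`); (d) the Laplace clauses from Stub 2 with `M = C_T(0)`. [folklore] -/
theorem HeatVarianceCalculus_of_stubs : CanonicalRigidityLine := by
  intro h1 h3 ω₂ lam β γ hω hl hβ T hT μ hG hSI hRefl D hP hShift
  -- superstability of the shift-invariant Gibbs state and the polynomial data of the chain (in tree)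
  have hss : (pinnedChain ω₂ lam β γ).HasSuperstabilityEstimate μ :=
    OscillatorChain.hasSuperstabilityEstimate_of_isShiftInvariant_pinnedChain γ hω hl.le hβ.le hT hG hSI
  have hU0 : ∀ q : ℝ, 0 ≤ (pinnedChain ω₂ lam β γ).U q :=
    OscillatorChain.pinnedChain_U_nonneg β γ hω.le hl.le
  have hUm : Measurable (pinnedChain ω₂ lam β γ).U := OscillatorChain.measurable_pinnedChain_U ω₂ lam β γ
  have hU2 : OscillatorChain.IsEvenPolyOfDegree (pinnedChain ω₂ lam β γ).U 2 :=
    OscillatorChain.pinnedChain_isEvenPolyOfDegree_U β γ hω.le hl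
  have hV2 : OscillatorChain.IsEvenPolyOfDegree (pinnedChain ω₂ lam β γ).V 2 :=
    OscillatorChain.pinnedChain_isEvenPolyOfDegree_V ω₂ lam γ hβ
  -- the canonical Buttà–Marchioro dynamics `D♭` (carrier `bmGood`, measurable flow, identity off `bmGood`)
  obtain ⟨D', hcar, hmeas, hid, -, -, -, hpresAll⟩ :=
    OscillatorChain.exists_bmDynamics (P := pinnedChain ω₂ lam β γ) one_le_two one_le_two hU2 hV2
  have hP' : D'.PreservesMeasure μ := hpresAll T μ hG hss
  -- RIGIDITY: the guarded `D` is `D♭` a.e., at all times; hence every correlation term agrees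
  have hrig := flow_ae_eq_canonical γ hω hl hβ hT hG hSI D D' hP hcar
  have hterm : ∀ (t : ℝ) (x : ℤ),
      ∫ σ, (pinnedChain ω₂ lam β γ).bondCurrentZ σ 0 *
          (pinnedChain ω₂ lam β γ).bondCurrentZ (D.flow t σ) x ∂μ =
        ∫ σ, (pinnedChain ω₂ lam β γ).bondCurrentZ σ 0 *
          (pinnedChain ω₂ lam β γ).bondCurrentZ (D'.flow t σ) x ∂μ := fun t x => by
    refine integral_congr_ae ?_
    filter_upwards [hrig] with σ hσ
    rw [hσ t]
  have hCC' : ∀ t : ℝ, D.currentCorrelation μ t = D'.currentCorrelation μ t := fun t => by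
    unfold InfiniteChainDynamics.currentCorrelation
    exact tsum_congr fun x => hterm t x
  have hCfun : (fun t : ℝ => D.currentCorrelation μ t) = fun t : ℝ => D'.currentCorrelation μ t :=
    funext hCC'
  -- the terms: integrable integrands (both dynamics) and continuity in `t` (canonical dynamics), in tree
  have hint : ∀ (t : ℝ) (x : ℤ), Integrable (fun σ =>
      (pinnedChain ω₂ lam β γ).bondCurrentZ σ 0 *
        (pinnedChain ω₂ lam β γ).bondCurrentZ (D.flow t σ) x) μ := fun t x =>
    hss.integrable_bondCurrentZ_mul_comp one_le_two hU0 hUm hV2 (hP.2 t) x 0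
  have hint' : ∀ (t : ℝ) (x : ℤ), Integrable (fun σ =>
      (pinnedChain ω₂ lam β γ).bondCurrentZ σ 0 *
        (pinnedChain ω₂ lam β γ).bondCurrentZ (D'.flow t σ) x) μ := fun t x =>
    hss.integrable_bondCurrentZ_mul_comp one_le_two hU0 hUm hV2 (hP'.2 t) x 0
  have hcont' : ∀ x : ℤ, Continuous fun t : ℝ =>
      ∫ σ, (pinnedChain ω₂ lam β γ).bondCurrentZ σ 0 *
        (pinnedChain ω₂ lam β γ).bondCurrentZ (D'.flow t σ) x ∂μ := fun x =>
    InfiniteChainDynamics.continuous_integral_bondCurrentZ_mul_flow_pinnedChain γ hω.le hl.le hβ hss D' hP' x 0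
  -- Stub 1 for the canonical pair
  have h1' := h1 ω₂ lam β γ hω hl hβ T hT μ hG hSI hRefl D' hcar hmeas hid
  -- (a) absolute convergence at every time, for `D♭` and (by rigidity) for `D`
  have hAC' : ∀ t : ℝ, D'.HasAbsConvergentCorrelation μ t := fun t => by
    obtain ⟨m, hm, hb⟩ := h1' |t|
    exact ⟨fun x => hint' t x,
      Summable.of_nonneg_of_le (fun x => abs_nonneg _) (fun x => hb t le_rfl x) hm⟩
  have hAC : ∀ t : ℝ, D.HasAbsConvergentCorrelation μ t := fun t => by
    obtain ⟨m, hm, hb⟩ := h1' |t|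
    refine ⟨fun x => hint t x, Summable.of_nonneg_of_le (fun x => abs_nonneg _) (fun x => ?_) hm⟩
    rw [hterm t x]
    exact hb t le_rfl x
  -- (b) continuity of `C_T` (for `D♭`, by the Weierstrass M-test on open windows; `C_T` of `D` is the same function)
  have hC' : Continuous fun t : ℝ => D'.currentCorrelation μ t := by
    refine continuous_iff_continuousAt.2 fun t₀ => ?_
    obtain ⟨m, hm, hb⟩ := h1' (|t₀| + 1)
    have hon : ContinuousOn (fun t : ℝ => ∑' x : ℤ,
        ∫ σ, (pinnedChain ω₂ lam β γ).bondCurrentZ σ 0 *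
          (pinnedChain ω₂ lam β γ).bondCurrentZ (D'.flow t σ) x ∂μ)
        (Set.Ioo (-(|t₀| + 1)) (|t₀| + 1)) :=
      continuousOn_tsum (fun x => (hcont' x).continuousOn) hm fun x t ht => by
        rw [Real.norm_eq_abs]
        exact hb t (abs_le.2 ⟨ht.1.le, ht.2.le⟩) x
    exact hon.continuousAt
      (Ioo_mem_nhds (by linarith [neg_abs_le t₀]) (by linarith [le_abs_self t₀]))
  have hC : Continuous fun t : ℝ => D.currentCorrelation μ t := by rw [hCfun]; exact hC'
  -- (c) positive type of the canonical autocorrelation (carrier `= bmGood`), in tree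
  obtain ⟨-, hbd', hpos'⟩ :=
    D'.currentCorrelation_positiveType_of_carrier_subset_bmGood one_le_two one_le_two hU2 hV2 hss hSI
      hcar.le hP' hAC'
  have hbd : ∀ t : ℝ, |D.currentCorrelation μ t| ≤ D.currentCorrelation μ 0 := fun t => by
    rw [hCC' t, hCC' 0]; exact hbd' t
  refine ⟨hAC, hC, fun V hV => ⟨fun τ hτ => ?_, fun ν hν => ?_⟩⟩
  · subst hV
    dsimp only
    refine mul_nonneg zero_le_two ?_
    have e : (fun s : ℝ => (τ - s) * D.currentCorrelation μ s) =
        fun s : ℝ => (τ - s) * D'.currentCorrelation μ s := funext fun s => by rw [hCC' s]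
    rw [e]
    exact hpos' τ hτ
  · -- (d) the Laplace clauses from Stub 2 with `M = C_T(0)`
    exact h3 (fun t : ℝ => D.currentCorrelation μ t) hC ⟨D.currentCorrelation μ 0, hbd⟩ V hV ν hν

/-- **Skeleton theorem (audit shape): the crux `HeatVarianceCalculus` BY NAME from the two declared stubs
by name** — `sorry` enters only through `stub_canonicalClusteringMajorant` and `stub_laplaceHeatVariance`;
closing the two stubs closes the crux verbatim. [folklore] -/
theorem HeatVarianceCalculus_of : Summit.AtomisticToContinuum.FouriersLaw.Theses.CageBudgetFekete.HeatVarianceCalculus :=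
  HeatVarianceCalculus_of_stubs stub_canonicalClusteringMajorant stub_laplaceHeatVariance

end Summit.AtomisticToContinuum.FouriersLaw.Cruxes.HeatVarianceCalculus.CanonicalRigidity
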